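import Summits.MatrixMultiplication.MatrixMultiplication.Theorems.LevelOneGL2Designs.Negative.LevelSpace

/-!
# Negative lemmas for the crux `LevelOneGL2Designs` (stmt-MatrixMultiplication-14080), part S:
the three SYMMETRIES of rank-`≤ k` separation used by every search and census

Certified-compute seat (`refuter-ccert-…-14080-0`); no theorem asserts a Theses statement
positively.  The off-box censuses (exhaustive enumeration of the profiles `(|X|,|Y|,|Z|)` of
rank-1-separated triples) reduce the search space by exactly these facts, which are therefore
stated and proved here for every `GL_m(𝔽_p)` and every level `k`:

* (S3) `rankSep_mono` — HEREDITY: sub-triples of a separated triple are separated (so the achievable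
  profiles form a down-set and clique-style pruning is sound);
* (S1) `rankSep_transl` — TWO-SIDED TRANSLATION: `(X, Y, Z) ↦ (gXa, gYh, gZb)` preserves separation
  (the quadruple products move by `q ↦ a⁻¹ q b`, and `F_k` is bi-invariant: part L's `transl`); hence
  `1 ∈ X ∩ Y ∩ Z` without loss and `Y` may be taken up to two-sided translation;
* (S2) `rankSep_swap` — the TRANSPOSE-INVERSE SWAP `(X, Y, Z) ↦ (Z^{−T}, Y^{−T}, X^{−T})` preserves
  separation (the new quadruple products are transposes of old ones with `y, y'` exchanged, and `F_k` is
  transpose-invariant: `rk Mᵀ = rk M`); hence the profile set is symmetric under `(a,b,c) ↔ (c,b,a)`.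
-/

set_option linter.dupNamespace false

noncomputable section

open scoped BigOperators

namespace Summit.MatrixMultiplication.MatrixMultiplication.Theorems.LevelOneGL2Designs.Negative

open Summit.MatrixMultiplication.MatrixMultiplication.Theorems.LieRankDesigns.Negative

variable {p m : ℕ} {k : ℕ}

/-! ## Transposition on `GL_m(𝔽_p)` -/

/-- Transpose of an invertible matrix, as an element of `GL_m(𝔽_p)`. -/
def transposeGL (g : GLm p m) : GLm p m where
  val := (g : Mat p m).transpose
  inv := ((g⁻¹ : GLm p m) : Mat p m).transpose
  val_inv := by rw [← Matrix.transpose_mul, Units.inv_mul, Matrix.transpose_one]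
  inv_val := by rw [← Matrix.transpose_mul, Units.mul_inv, Matrix.transpose_one]

/-- The underlying matrix of `transposeGL g`. -/
@[simp] theorem val_transposeGL (g : GLm p m) :
    ((transposeGL g : GLm p m) : Mat p m) = (g : Mat p m).transpose :=
  rfl

/-- The underlying matrix of the inverse of `transposeGL g`. -/
@[simp] theorem val_inv_transposeGL (g : GLm p m) :
    (((transposeGL g)⁻¹ : GLm p m) : Mat p m) = ((g⁻¹ : GLm p m) : Mat p m).transpose :=
  rfl

/-- `transposeGL` is injective. -/
theorem transposeGL_injective : Function.Injective (transposeGL : GLm p m → GLm p m) := by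
  intro g h hgh
  apply Units.ext
  have := congrArg (fun u : GLm p m => (u : Mat p m)) hgh
  simpa using congrArg Matrix.transpose this

/-- The swap map `g ↦ (gᵀ)⁻¹`. -/
def invT (g : GLm p m) : GLm p m := (transposeGL g)⁻¹

/-- `invT` is injective. -/
theorem invT_injective : Function.Injective (invT : GLm p m → GLm p m) :=
  fun _ _ hgh => transposeGL_injective (inv_injective hgh)

/-- The swap on cardinalities: profiles `(a, b, c)` and `(c, b, a)` are achieved together. -/
theorem card_image_invT [DecidableEq (GLm p m)] (S : Finset (GLm p m)) :
    (S.image invT).card = S.card :=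
  Finset.card_image_of_injective _ invT_injective

/-- The swap sends a quadruple product to the transpose of a quadruple product with `y₁, y₂`
exchanged: `((z^{−T})⁻¹ y₁^{−T} (y₂^{−T})⁻¹ x^{−T})ᵀ = x⁻¹ y₂ y₁⁻¹ z`. -/
theorem transposeGL_swap_product (x y₁ y₂ z : GLm p m) :
    transposeGL ((invT z)⁻¹ * invT y₁ * (invT y₂)⁻¹ * invT x) = x⁻¹ * y₂ * y₁⁻¹ * z := by
  apply Units.ext
  simp [invT, Matrix.transpose_mul, Matrix.transpose_transpose, mul_assoc,
    ← Matrix.transpose_nonsing_inv]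

/-- The transposed coefficient table. -/
def translT (c : Mat p m → ℂ) : Mat p m → ℂ := fun M => c M.transpose

variable [Fact p.Prime]

/-! ## (S3) Heredity -/

/-- **Heredity**: sub-triples of an `F_k`-separated triple are `F_k`-separated. -/
theorem rankSep_mono {X Y Z X' Y' Z' : Finset (GLm p m)} (hX : X' ⊆ X) (hY : Y' ⊆ Y) (hZ : Z' ⊆ Z)
    (hsep : RankSep k X Y Z) : RankSep k X' Y' Z' := by
  intro x₀ hx₀ z₀ hz₀
  obtain ⟨c, hc, hsepc⟩ := hsep x₀ (hX hx₀) z₀ (hZ hz₀)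
  exact ⟨c, hc, fun x hx y hy y' hy' z hz => hsepc x (hX hx) y (hY hy) y' (hY hy') z (hZ hz)⟩

/-! ## (S1) Two-sided translation -/

/-- **Two-sided translation**: `(X, Y, Z) ↦ (gXa, gYh, gZb)` preserves `F_k`-separation. -/
theorem rankSep_transl {X Y Z : Finset (GLm p m)} (hsep : RankSep k X Y Z) (g a h b : GLm p m) :
    RankSep k (X.image fun x => g * x * a) (Y.image fun y => g * y * h)
      (Z.image fun z => g * z * b) := by
  classical
  intro x₀' hx₀' z₀' hz₀'
  obtain ⟨x₀, hx₀, rfl⟩ := Finset.mem_image.mp hx₀'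
  obtain ⟨z₀, hz₀, rfl⟩ := Finset.mem_image.mp hz₀'
  obtain ⟨c, hc, hsepc⟩ := hsep x₀ hx₀ z₀ hz₀
  -- the table realising `q ↦ fourierFn c (a q b⁻¹)`
  refine ⟨transl b⁻¹ a c, rankSupp_transl _ _ hc, fun x' hx' y₁' hy₁' y₂' hy₂' z' hz' => ?_⟩
  obtain ⟨x, hx, rfl⟩ := Finset.mem_image.mp hx'
  obtain ⟨y₁, hy₁, rfl⟩ := Finset.mem_image.mp hy₁'
  obtain ⟨y₂, hy₂, rfl⟩ := Finset.mem_image.mp hy₂'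
  obtain ⟨z, hz, rfl⟩ := Finset.mem_image.mp hz'
  rw [fourierFn_transl]
  have hq : a * ((g * x * a)⁻¹ * (g * y₁ * h) * (g * y₂ * h)⁻¹ * (g * z * b)) * b⁻¹ =
      x⁻¹ * y₁ * y₂⁻¹ * z := by group
  rw [hq, hsepc x hx y₁ hy₁ y₂ hy₂ z hz]
  -- the target conditions agree (translation is injective)
  by_cases hxyz : x = x₀ ∧ y₁ = y₂ ∧ z = z₀
  · obtain ⟨rfl, rfl, rfl⟩ := hxyz
    rw [if_pos ⟨rfl, rfl, rfl⟩, if_pos ⟨rfl, rfl, rfl⟩]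
  · rw [if_neg hxyz, if_neg]
    rintro ⟨h1, h2, h3⟩
    exact hxyz ⟨by simpa using h1, by simpa using h2, by simpa using h3⟩

/-! ## (S2) The transpose-inverse swap -/

/-- Transposing the table realises `g ↦ fourierFn c (gᵀ)`. [folklore] -/
theorem fourierFn_translT (c : Mat p m → ℂ) (g : GLm p m) :
    fourierFn (translT c) g = fourierFn c (transposeGL g) := by
  unfold fourierFn translT
  rw [← Equiv.sum_comp (Matrix.transposeAddEquiv (Fin m) (Fin m) (ZMod p)).toEquiv]
  refine Finset.sum_congr rfl fun M _ => ?_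
  simp only [AddEquiv.toEquiv_eq_coe, AddEquiv.coe_toEquiv, Matrix.transposeAddEquiv_apply,
    Matrix.transpose_transpose, val_transposeGL]
  congr 2
  rw [← Matrix.trace_transpose (M * _), Matrix.transpose_mul, Matrix.transpose_transpose,
    Matrix.trace_mul_comm]

/-- The transposed table has the same rank support. [folklore] -/
theorem rankSupp_translT {c : Mat p m → ℂ} (hc : RankSupp k c) : RankSupp k (translT c) := by
  intro M hM
  unfold translT
  exact hc _ (by rwa [Matrix.rank_transpose])

/-- **The transpose-inverse swap** `(X, Y, Z) ↦ (Z^{−T}, Y^{−T}, X^{−T})` preserves `F_k`-separation: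
the new quadruple product for `(z^{−T}, y₁^{−T}, y₂^{−T}, x^{−T})` is `(x⁻¹ y₂ y₁⁻¹ z)ᵀ`, the target
conditions correspond, and `g ↦ f(gᵀ)` is again of level `k`. -/
theorem rankSep_swap {X Y Z : Finset (GLm p m)} (hsep : RankSep k X Y Z) :
    RankSep k (Z.image invT) (Y.image invT) (X.image invT) := by
  classical
  intro z₀' hz₀' x₀' hx₀'
  obtain ⟨z₀, hz₀, rfl⟩ := Finset.mem_image.mp hz₀'
  obtain ⟨x₀, hx₀, rfl⟩ := Finset.mem_image.mp hx₀'
  obtain ⟨c, hc, hsepc⟩ := hsep x₀ hx₀ z₀ hz₀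
  refine ⟨translT c, rankSupp_translT hc, fun z' hz' y₁' hy₁' y₂' hy₂' x' hx' => ?_⟩
  obtain ⟨z, hz, rfl⟩ := Finset.mem_image.mp hz'
  obtain ⟨y₁, hy₁, rfl⟩ := Finset.mem_image.mp hy₁'
  obtain ⟨y₂, hy₂, rfl⟩ := Finset.mem_image.mp hy₂'
  obtain ⟨x, hx, rfl⟩ := Finset.mem_image.mp hx'
  rw [fourierFn_translT, transposeGL_swap_product, hsepc x hx y₂ hy₂ y₁ hy₁ z hz]
  by_cases hxyz : x = x₀ ∧ y₂ = y₁ ∧ z = z₀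
  · obtain ⟨rfl, rfl, rfl⟩ := hxyz
    rw [if_pos ⟨rfl, rfl, rfl⟩, if_pos ⟨rfl, rfl, rfl⟩]
  · rw [if_neg hxyz, if_neg]
    rintro ⟨h1, h2, h3⟩
    exact hxyz ⟨invT_injective h3, (invT_injective h2).symm, invT_injective h1⟩

end Summit.MatrixMultiplication.MatrixMultiplication.Theorems.LevelOneGL2Designs.Negative

end
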